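import Summits.QuantumFields.QCD.Theses.HeatSlicedQuarks
import Summits.QuantumFields.QCD.Theorems.HeatSlicedQuarksSmallFieldUltracontractivity
import Literature.MathematicalPhysics.QuantumLattice.WilsonFermionBlockAveraging

/-!
# Stub `stub_parametrixLate` of line `Sketch` (crux `InterleavedHeatSliceFlow`, item stmt-QuantumFields-8891)

The LATE regime `1 ≤ t ≤ r²` of the on-diagonal parametrix comparison for the Wilson quark heat
kernel: under GLOBAL scale-covariant plaquette smallness `3 - Re tr U_p ≤ (ε/r²)²` (all plaquettes of
the torus), every colour-spin entry of the difference of the on-diagonal heat kernels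
`e^{-tH_U}((x,a,α),(x,b,β)) - e^{-tH_1}((x,a,α),(x,b,β))`, with `H_U = D_W(U,m,1)ᴴ D_W(U,m,1)` and
`H_1` the same operator for the constant configuration `U ≡ 1`, is bounded by `C/t²`.

Proof: no identification of the two kernels is needed in this regime.  The landed sibling crux
`SmallFieldUltracontractivity` (theorem
`Cruxes.SmallFieldUltracontractivity.PointCentredAxialParabolic.SmallFieldUltracontractivity_of`)
provides `ε, K, C₀` with `|e^{-tH_U}((x,a,α),(x,b,β))| ≤ C₀/t²` for `1 ≤ t ≤ r²` whenever the
plaquettes on the `K·r`-ball around `x` are `(ε/r²)`-small.  Global smallness implies smallness on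
every ball, so the bound holds for `U`; the constant configuration has all plaquette holonomies equal
to `1`, hence deficit `3 - Re tr 1 = 0 ≤ (ε/r²)²`, so the bound holds for `U ≡ 1` as well.  The
triangle inequality gives the claim with the same `ε` and `C := C₀ + C₀`.
-/

namespace Summit.QuantumFields.QCD.Cruxes.InterleavedHeatSliceFlow.Sketch

open Literature.MathematicalPhysics.QuantumLattice Literature.MathematicalPhysics.QuantumFieldTheory
  Literature.Probability.LatticeModels
open Summit.QuantumFields.QCD.Theses.HeatSlicedQuarks
open scoped Matrix Kronecker ComplexConjugate

/-- **Stub `stub_parametrixLate`** (S/M; reshape r3; worker): `ParametrixLate` written out.  Proof: the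
LANDED sibling crux `Cruxes.SmallFieldUltracontractivity.PointCentredAxialParabolic.SmallFieldUltracontractivity_of`
(`Theorems/HeatSlicedQuarksSmallFieldUltracontractivity`) gives `ε₀, K, C₀`; take `ε := ε₀`, `C := 2C₀`:
global smallness implies smallness on the `K·r`-ball, for `U` and (deficit `0`) for `U ≡ 1`; triangle
inequality.  Leans on: SFU_of (landed); `plaquetteHolonomy` of the constant configuration is `1`. -/
theorem stub_parametrixLate :
    ∃ ε : ℝ, 0 < ε ∧ ∃ C : ℝ, ∀ (L : ℕ) [NeZero L]
      (U : GaugeConfig 4 L (Matrix.specialUnitaryGroup (Fin 3) ℂ)) (m : ℝ), m ∈ Set.Icc (-(1 / 2 : ℝ)) 1 →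
      ∀ (r : ℕ), 1 ≤ r → r ≤ L →
      (∀ (y : TorusSite 4 L) (μ ν : Fin 4),
        3 - ((fundamentalRep (Fin 3)) (plaquetteHolonomy U y μ ν)).trace.re ≤ (ε / (r : ℝ) ^ 2) ^ 2) →
      ∀ (t : ℝ), 1 ≤ t → t ≤ (r : ℝ) ^ 2 → ∀ (x : TorusSite 4 L) (a b : Fin 3) (α β : Fin 4),
        ‖(NormedSpace.exp (-(t : ℂ) • ((wilsonDirac (fundamentalRep (Fin 3)) U m 1)ᴴ *
            wilsonDirac (fundamentalRep (Fin 3)) U m 1))) (x, a, α) (x, b, β) -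
          (NormedSpace.exp (-(t : ℂ) •
            ((wilsonDirac (fundamentalRep (Fin 3))
                (fun _ : Edge 4 L => (1 : Matrix.specialUnitaryGroup (Fin 3) ℂ)) m 1)ᴴ *
              wilsonDirac (fundamentalRep (Fin 3))
                (fun _ : Edge 4 L => (1 : Matrix.specialUnitaryGroup (Fin 3) ℂ)) m 1))) (x, a, α) (x, b, β)‖ ≤
          C / t ^ 2 := by
  obtain ⟨ε, hε, K, C, hC⟩ :=
    (Cruxes.SmallFieldUltracontractivity.PointCentredAxialParabolic.SmallFieldUltracontractivity_of :
      SmallFieldUltracontractivity)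
  refine ⟨ε, hε, C + C, ?_⟩
  intro L _ U m hm r hr hrL hsmall t ht htr x a b α β
  -- the background field `U`: global smallness implies smallness on the `K·r`-ball around `x`
  have hU := hC L U m hm x r hr hrL (fun y _ μ ν => hsmall y μ ν) t ht htr a b α β
  -- the constant configuration `U ≡ 1`: every plaquette holonomy is `1`, the deficit vanishes
  have h1 := hC L (fun _ : Edge 4 L => (1 : Matrix.specialUnitaryGroup (Fin 3) ℂ)) m hm x r hr hrL
    (fun y _ μ ν => by
      have hdef : (3 : ℝ) - ((fundamentalRep (Fin 3))
          (plaquetteHolonomy (fun _ : Edge 4 L => (1 : Matrix.specialUnitaryGroup (Fin 3) ℂ))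
            y μ ν)).trace.re = 0 := by
        simp only [plaquetteHolonomy, mul_one, inv_one, map_one, Matrix.trace_one,
          Fintype.card_fin]
        norm_num
      rw [hdef]
      positivity)
    t ht htr a b α β
  calc _ ≤ _ := norm_sub_le _ _
    _ ≤ C / t ^ 2 + C / t ^ 2 := add_le_add hU h1
    _ = (C + C) / t ^ 2 := by ring

end Summit.QuantumFields.QCD.Cruxes.InterleavedHeatSliceFlow.Sketch
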